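import Summits.QuantumFields.YangMills.Theorems.BalabanUVNodesN16Eq42PermutationDefectNonAbelian
import Summits.QuantumFields.YangMills.Theorems.BalabanUVNodesN16Eq42VsSymmetrisedLinear
import HarnessLib

/-!
# YM-DAG node N16 (NE3), the located averaging pin (42) ↔ (0.4) — part 5: THE NON-ABELIAN (0.4)-SHAPED RECIPE AGAINST (42) TO FIRST ORDER —
# the recipe's exponent is within `d(d+2)L³δ + 2ρ₂(ℓ,a)` of (42)'s (second order only at constant curvature), and so are the averages

Cell `pub-ymgap`, width seat `pub-ymgap-dag-n16-w3` (director-ym №197 ∕ HUMAN RULING D-0149), generation 2; part 5 of the W1b sequel, over part 3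
`…PermutationDefectNonAbelian` (the non-abelian exponent of (42) against its linearisation, `ρ₂(ℓ,a) = ρ(2(e^{ℓa} − 1)) + ρ(ℓa)`) and part 4
`…VsSymmetrisedLinear` (the symmetrised LINEAR exponent `XhatSym` = Reynolds average of (42)'s; `≤ d(d+2)L³δ` from `X̂`).
`--kind proof --supports stmt-QuantumFields-20544 --as helper` (0 `def`: the recipe's exponent and average are DISPLAYED sums written out in each
statement; K3⁷; count-neutral).
RELATION TO lit-balaban's b12 leaves (cited, nothing restated): `B12ContourAverage253` ∕ `B12SmallFieldRegion255` type the averaged-contour-variable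
average (0.11)∕(0.12) (Federbush mean (0.10) of the transporters `U(Γ^π)`, then ONE logarithm) on the same corner cubes and record the contour-PAIR
average (0.4) — the double mean of LOGARITHMS displayed here as «XavgSym» — as NOT typed there; the two recipes share the linearisation `XhatSym` (part 4).

THE POINT.  For a group-valued (`U(N) ⊂ M_N(ℂ)`, or any complete normed `ℂ`-algebra with `‖1‖ = 1`) configuration `V` the (0.4)-shaped recipe on
B7's corner blocks has the exponent `XavgSym[V](q,κ) := Σ_r L^{−d} • |Sym|^{−2} • Σ_{σ,σ′} log V(Γ^σ_{c₋,x} ∪ [x,x′] ∪ −Γ^{σ′}_{c₊,x′} ∪ −c)` (§1) and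
the average `bavgSymNA := e^{XavgSym}·V(Γ_c)` (both DISPLAYED, §1).  Written near the block as `V_b = e^{A_b}`, `‖A_b‖ ≤ a` within `|·|₁`-distance `ℓ = 2dL + 2L` of `c₋`
(`e^{ℓa} − 1 ≤ ½`): §2 `norm_XavgSym_sub_XhatSym_le` (`‖XavgSym[V] − XhatSym[A]‖ ≤ ρ₂(ℓ,a)`: every recipe loop has length `≤ ℓ`, part 3's
`norm_mlog_hol_sub_asum_le` termwise); §3 ★★ `norm_XavgSym_sub_Xavg_le`: `‖XavgSym[V] − X[V]‖ ≤ d(d+2)L³δ + 2ρ₂(ℓ,a)` for `δ`-Lipschitz circulations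
of `A` in the planes `(m, κ)` (part 4's `norm_XhatSym_sub_Xhat_le` between the two linearisations), and ★ `≤ 2ρ₂(ℓ,a)` at CONSTANT CURVATURE
(`norm_XavgSym_sub_Xavg_le_of_const_flux`, part 4's `XhatSym_eq_Xhat_of_const_flux`); §4 ★★ `norm_bavgSymNA_sub_bavg_le`: for `U1`-valued `V`,
`‖bavgSymNA[V](c) − V̄_c‖ ≤ e·(d(d+2)L³δ + 2ρ₂(ℓ,a))` (common straight transporter of norm `≤ 1`; exponents of norm `≤ 1`, `exp` `e`-Lipschitz there).

READING FOR N16 (honest; no minimiser statement).  At the tree's actual (non-abelian) objects the two averaging RECIPES of the located pin differ,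
per coarse bond and in a local exponential gauge, by [Lipschitz-flux term] + [second order in the potential] — `O(d²L³cη³ + d⁴L⁴b²η⁴)` on a level-`j`
field of [B11]-Thm-1 TYPE regularity — against their common first-order size `O(dL²bη²)`.  CAVEATS as in part 4: corner blocks; the tree's
torus-typed (0.4) OBJECT (`BlockAveraging.blockAvg expMeanLogSU`) is not bridged; nothing about minimisers or the transfer Props is proved.

HONEST FRAMING.  [folklore] bookkeeping over parts 3–4 BY NAME; 0 `def`, 0 `sorry`; the local-gauge representation is a displayed
HYPOTHESIS; nothing of [Balaban1985Averaging] ∕ [Balaban1987RG1] asserted beyond what the tree proves; `stub_h7` NOT closed; N16 ∕ NE3 NOT discharged;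
count-neutral (typed 28∕28 · discharged 5∕27 unmoved).  One finite four-torus programme at fixed `ε` — the Yang–Mills mass gap (Clay) is NOT proved by
any of this; R4 closes the conditional finite-𝕋⁴ rung `BalabanLadder.UV` only; nothing continuum ∕ ℝ⁴ ∕ OS.
-/

set_option autoImplicit false

open scoped BigOperators
open NormedSpace Finset

namespace Summit.QuantumFields.YangMills.BalabanUVNodes.N16Eq42VsSymmetrisedNonAbelian

open Literature.MathematicalPhysics.QuantumFieldTheory.Balaban1983to89
open B7Prop1Explicit
open B12Average012Permutation (permSite permCfg permCfg_apply)
open B12ContourAverage253 (permWord disp_permWord length_permWord)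
open Summit.QuantumFields.YangMills.BalabanUVNodes.N16Eq42PermutationDefect
open Summit.QuantumFields.YangMills.BalabanUVNodes.N16Eq42PermutationDefectNonAbelian
open Summit.QuantumFields.YangMills.BalabanUVNodes.N16Eq42VsSymmetrisedLinear

noncomputable section

variable {d : ℕ}
variable {𝔸 : Type*} [NormedRing 𝔸] [NormOneClass 𝔸] [NormedAlgebra ℂ 𝔸] [CompleteSpace 𝔸]

/-! ## §1 The recipe's non-abelian exponent and average on corner blocks (displayed sums)

Throughout, «`XavgSym[V](q,κ)`» in the docstrings denotes the DISPLAYED sum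
`Σ_r L^{−d} • |Sym|^{−2} • Σ_{σ,σ′} log V(permWord σ v ++ seg κ L ++ revWord (permWord σ′ v) ++ seg κ (−L))`, `v = boxVec L r` (the (0.4)-shaped
non-abelian exponent on corner blocks), «`XhatSym[A](q,κ)`» part 4's displayed linear sum, and «`bavgSymNA[V](q,κ)`» the unit
`expUnit (XavgSym[V](q,κ)) * V(Γ_c)`; all three are written out in every statement (no `def`: proof-lane file). -/

/-! ## §2 The recipe's exponent against its linearisation -/

omit [NormOneClass 𝔸] [NormedAlgebra ℂ 𝔸] [CompleteSpace 𝔸] in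
/-- The recipe's loops have length `≤ ℓ = 2dL + 2L` (the `σ`-ordered broken lines have the tree contour's length `|v|₁`). [folklore] -/
theorem length_symLoop_le (L : ℕ) (κ : Fin d) (σ σ' : Equiv.Perm (Fin d)) (r : Fin d → Fin L) :
    (permWord σ (boxVec L r) ++ seg κ L ++ revWord (permWord σ' (boxVec L r)) ++ seg κ (-(L : ℤ))).length ≤ 2 * (d * L) + L + L := by
  simp only [List.length_append, length_permWord, length_revWord, length_seg, Int.natAbs_neg, Int.natAbs_natCast]
  have := l1_boxVec_le L r
  nlinarith

omit [NormOneClass 𝔸] in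
/-- **`XavgSym[V] = XhatSym[A] + O((ℓa)²)`**: for `V_b = e^{A_b}`, `‖A_b‖ ≤ a` within `|·|₁`-distance `ℓ` of `q` and `e^{ℓa} − 1 ≤ ½`,
`‖XavgSym[V](q,κ) − XhatSym[A](q,κ)‖ ≤ ρ₂(ℓ,a)` (part 3's `norm_mlog_hol_sub_asum_le` on every recipe loop, averaged). [folklore] -/
theorem norm_XavgSym_sub_XhatSym_le (L : ℕ) (hL : 1 ≤ L) (V : Site d → Fin d → 𝔸ˣ) (A : Site d → Fin d → 𝔸) (q : Site d) (κ : Fin d)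
    {a : ℝ} (ha : 0 ≤ a)
    (hVA : ∀ (x : Site d) (μ : Fin d), l1 (x - q) ≤ 2 * (d * L) + L + L → ((V x μ : 𝔸ˣ) : 𝔸) = exp (A x μ) ∧ ‖A x μ‖ ≤ a)
    (hsmall : Real.exp (((2 * (d * L) + L + L : ℕ) : ℝ) * a) - 1 ≤ 1 / 2) :
    ‖(∑ r : Fin d → Fin L, (((L : ℝ) ^ d)⁻¹) • ((((Fintype.card (Equiv.Perm (Fin d)) : ℝ) ^ 2)⁻¹) •
        ∑ σ : Equiv.Perm (Fin d), ∑ σ' : Equiv.Perm (Fin d),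
          MatrixLog.mlog ((hol V q (permWord σ (boxVec L r) ++ seg κ L ++ revWord (permWord σ' (boxVec L r)) ++ seg κ (-(L : ℤ))) : 𝔸ˣ) : 𝔸))) - (∑ r : Fin d → Fin L, (((L : ℝ) ^ d)⁻¹) • ((((Fintype.card (Equiv.Perm (Fin d)) : ℝ) ^ 2)⁻¹) •
        ∑ σ : Equiv.Perm (Fin d), ∑ σ' : Equiv.Perm (Fin d),
          asum A q (permWord σ (boxVec L r) ++ seg κ L ++ revWord (permWord σ' (boxVec L r)) ++ seg κ (-(L : ℤ)))))‖
      ≤ expRem (2 * (Real.exp (((2 * (d * L) + L + L : ℕ) : ℝ) * a) - 1)) + expRem (((2 * (d * L) + L + L : ℕ) : ℝ) * a) := by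
  set ℓ : ℕ := 2 * (d * L) + L + L with hℓ
  set B : ℝ := expRem (2 * (Real.exp ((ℓ : ℝ) * a) - 1)) + expRem ((ℓ : ℝ) * a) with hB
  set N : ℝ := (Fintype.card (Equiv.Perm (Fin d)) : ℝ) with hNdef
  have hN : N ≠ 0 := by rw [hNdef]; exact_mod_cast Fintype.card_ne_zero
  have hNpos : 0 < N := by rw [hNdef]; exact_mod_cast Fintype.card_pos
  have hL0 : (0 : ℝ) < (L : ℝ) ^ d := pow_pos (by exact_mod_cast (by omega : 0 < L)) _
  have hB0 : 0 ≤ B := add_nonneg (expRem_nonneg _) (expRem_nonneg _)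
  -- termwise second-order bound on every recipe loop
  have hterm : ∀ (r : Fin d → Fin L) (σ σ' : Equiv.Perm (Fin d)),
      ‖MatrixLog.mlog ((hol V q (permWord σ (boxVec L r) ++ seg κ L ++ revWord (permWord σ' (boxVec L r)) ++ seg κ (-(L : ℤ))) : 𝔸ˣ) : 𝔸)
        - asum A q (permWord σ (boxVec L r) ++ seg κ L ++ revWord (permWord σ' (boxVec L r)) ++ seg κ (-(L : ℤ)))‖ ≤ B := by
    intro r σ σ'
    set w := permWord σ (boxVec L r) ++ seg κ L ++ revWord (permWord σ' (boxVec L r)) ++ seg κ (-(L : ℤ)) with hw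
    have hlen : w.length ≤ ℓ := length_symLoop_le L κ σ σ' r
    have hna : (w.length : ℝ) * a ≤ (ℓ : ℝ) * a := mul_le_mul_of_nonneg_right (by exact_mod_cast hlen) ha
    have hexp : Real.exp (w.length * a) - 1 ≤ Real.exp ((ℓ : ℝ) * a) - 1 := by linarith [Real.exp_le_exp.mpr hna]
    have h := norm_mlog_hol_sub_asum_le V A q ℓ ha hVA w q (by simp [l1]; exact hlen) (hexp.trans hsmall)
    refine h.trans (add_le_add (expRem_mono (by
        have := Real.one_le_exp (by positivity : (0 : ℝ) ≤ w.length * a); positivity) (by linarith))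
      (expRem_mono (by positivity) hna))
  -- average: ‖mean of terms each ≤ B‖ ≤ B
  rw [← Finset.sum_sub_distrib]
  calc ‖∑ r : Fin d → Fin L, ((((L : ℝ) ^ d)⁻¹) • ((N ^ 2)⁻¹ • ∑ σ : Equiv.Perm (Fin d), ∑ σ' : Equiv.Perm (Fin d),
            MatrixLog.mlog ((hol V q (permWord σ (boxVec L r) ++ seg κ L ++ revWord (permWord σ' (boxVec L r)) ++ seg κ (-(L : ℤ))) : 𝔸ˣ) : 𝔸))
          - (((L : ℝ) ^ d)⁻¹) • ((N ^ 2)⁻¹ • ∑ σ : Equiv.Perm (Fin d), ∑ σ' : Equiv.Perm (Fin d),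
            asum A q (permWord σ (boxVec L r) ++ seg κ L ++ revWord (permWord σ' (boxVec L r)) ++ seg κ (-(L : ℤ)))))‖
      ≤ ∑ r : Fin d → Fin L, ‖(((L : ℝ) ^ d)⁻¹) • ((N ^ 2)⁻¹ • ∑ σ : Equiv.Perm (Fin d), ∑ σ' : Equiv.Perm (Fin d),
            MatrixLog.mlog ((hol V q (permWord σ (boxVec L r) ++ seg κ L ++ revWord (permWord σ' (boxVec L r)) ++ seg κ (-(L : ℤ))) : 𝔸ˣ) : 𝔸))
          - (((L : ℝ) ^ d)⁻¹) • ((N ^ 2)⁻¹ • ∑ σ : Equiv.Perm (Fin d), ∑ σ' : Equiv.Perm (Fin d),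
            asum A q (permWord σ (boxVec L r) ++ seg κ L ++ revWord (permWord σ' (boxVec L r)) ++ seg κ (-(L : ℤ))))‖ := norm_sum_le _ _
    _ ≤ ∑ _r : Fin d → Fin L, ((L : ℝ) ^ d)⁻¹ * B := Finset.sum_le_sum fun r _ => by
        rw [← smul_sub, ← smul_sub, ← Finset.sum_sub_distrib, norm_smul, norm_inv, Real.norm_of_nonneg hL0.le]
        refine mul_le_mul_of_nonneg_left ?_ (by positivity)
        rw [norm_smul, norm_inv, norm_pow, Real.norm_of_nonneg hNpos.le]
        calc (N ^ 2)⁻¹ * ‖∑ σ : Equiv.Perm (Fin d), (∑ σ' : Equiv.Perm (Fin d),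
                MatrixLog.mlog ((hol V q (permWord σ (boxVec L r) ++ seg κ L ++ revWord (permWord σ' (boxVec L r)) ++ seg κ (-(L : ℤ))) : 𝔸ˣ) : 𝔸)
                - ∑ σ' : Equiv.Perm (Fin d),
                asum A q (permWord σ (boxVec L r) ++ seg κ L ++ revWord (permWord σ' (boxVec L r)) ++ seg κ (-(L : ℤ))))‖
            ≤ (N ^ 2)⁻¹ * ∑ σ : Equiv.Perm (Fin d), ∑ σ' : Equiv.Perm (Fin d), B := by
              refine mul_le_mul_of_nonneg_left ((norm_sum_le _ _).trans (Finset.sum_le_sum fun σ _ => ?_)) (by positivity)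
              rw [← Finset.sum_sub_distrib]
              exact (norm_sum_le _ _).trans (Finset.sum_le_sum fun σ' _ => hterm r σ σ')
          _ = B := by
              rw [Finset.sum_const, Finset.sum_const, Finset.card_univ, nsmul_eq_mul, nsmul_eq_mul, ← hNdef]
              field_simp
    _ = B := by
        rw [Finset.sum_const, Finset.card_univ, Fintype.card_fun, Fintype.card_fin, Fintype.card_fin, nsmul_eq_mul]
        push_cast
        field_simp

/-! ## §3 The recipe's exponent against (42)'s -/

omit [NormOneClass 𝔸] in
/-- **★★ THE NON-ABELIAN RECIPE AGAINST (42), EXPONENTS**: `‖XavgSym[V](c) − X[V](c)‖ ≤ d(d+2)L³·δ + 2ρ₂(ℓ,a)` — through the two linearisations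
(part 4's `norm_XhatSym_sub_Xhat_le` in the middle, §2 and part 3's `norm_Xavg_sub_Xhat_le` at the ends). [folklore] -/
theorem norm_XavgSym_sub_Xavg_le (L : ℕ) (hL : 1 ≤ L) (V : Site d → Fin d → 𝔸ˣ) (A : Site d → Fin d → 𝔸) (q : Site d) (κ : Fin d)
    {a : ℝ} (ha : 0 ≤ a)
    (hVA : ∀ (x : Site d) (μ : Fin d), l1 (x - q) ≤ 2 * (d * L) + L + L → ((V x μ : 𝔸ˣ) : 𝔸) = exp (A x μ) ∧ ‖A x μ‖ ≤ a)
    (hsmall : Real.exp (((2 * (d * L) + L + L : ℕ) : ℝ) * a) - 1 ≤ 1 / 2) {δ : ℝ} (hδ0 : 0 ≤ δ)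
    (hδ : ∀ (p : Site d) (m : Fin d), l1 (p - q) ≤ (d + 2) * L →
      ‖asum A p (plaqWord m κ) - asum A q (plaqWord m κ)‖ ≤ δ * l1 (p - q)) :
    ‖(∑ r : Fin d → Fin L, (((L : ℝ) ^ d)⁻¹) • ((((Fintype.card (Equiv.Perm (Fin d)) : ℝ) ^ 2)⁻¹) •
        ∑ σ : Equiv.Perm (Fin d), ∑ σ' : Equiv.Perm (Fin d),
          MatrixLog.mlog ((hol V q (permWord σ (boxVec L r) ++ seg κ L ++ revWord (permWord σ' (boxVec L r)) ++ seg κ (-(L : ℤ))) : 𝔸ˣ) : 𝔸))) - Xavg L V q κ‖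
      ≤ d * (d + 2) * (L : ℝ) ^ 3 * δ
        + 2 * (expRem (2 * (Real.exp (((2 * (d * L) + L + L : ℕ) : ℝ) * a) - 1))
            + expRem (((2 * (d * L) + L + L : ℕ) : ℝ) * a)) := by
  have h1 := norm_XavgSym_sub_XhatSym_le L hL V A q κ ha hVA hsmall
  have h2 := norm_XhatSym_sub_Xhat_le L hL A q κ hδ0 hδ
  have h3 := norm_Xavg_sub_Xhat_le L hL V A q κ ha hVA hsmall
  set XV : 𝔸 := (∑ r : Fin d → Fin L, (((L : ℝ) ^ d)⁻¹) • ((((Fintype.card (Equiv.Perm (Fin d)) : ℝ) ^ 2)⁻¹) •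
        ∑ σ : Equiv.Perm (Fin d), ∑ σ' : Equiv.Perm (Fin d),
          MatrixLog.mlog ((hol V q (permWord σ (boxVec L r) ++ seg κ L ++ revWord (permWord σ' (boxVec L r)) ++ seg κ (-(L : ℤ))) : 𝔸ˣ) : 𝔸))) with hXV
  set XS : 𝔸 := (∑ r : Fin d → Fin L, (((L : ℝ) ^ d)⁻¹) • ((((Fintype.card (Equiv.Perm (Fin d)) : ℝ) ^ 2)⁻¹) •
        ∑ σ : Equiv.Perm (Fin d), ∑ σ' : Equiv.Perm (Fin d),
          asum A q (permWord σ (boxVec L r) ++ seg κ L ++ revWord (permWord σ' (boxVec L r)) ++ seg κ (-(L : ℤ))))) with hXS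
  calc ‖XV - Xavg L V q κ‖ = ‖(XV - XS) + (XS - Xhat L A q κ) - (Xavg L V q κ - Xhat L A q κ)‖ := by congr 1; abel
    _ ≤ ‖XV - XS‖ + ‖XS - Xhat L A q κ‖ + ‖Xavg L V q κ - Xhat L A q κ‖ :=
        (norm_sub_le _ _).trans (add_le_add (norm_add_le _ _) le_rfl)
    _ ≤ _ := by linarith

omit [NormOneClass 𝔸] in
/-- **★ AT CONSTANT CURVATURE THE TWO NON-ABELIAN EXPONENTS DIFFER AT SECOND ORDER ONLY**: `‖XavgSym[V](c) − X[V](c)‖ ≤ 2ρ₂(ℓ,a)` when the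
circulations of `A` in the planes `(m, κ)` do not depend on the base point (part 4's `XhatSym_eq_Xhat_of_const_flux`). [folklore] -/
theorem norm_XavgSym_sub_Xavg_le_of_const_flux (L : ℕ) (hL : 1 ≤ L) (V : Site d → Fin d → 𝔸ˣ) (A : Site d → Fin d → 𝔸)
    (q : Site d) (κ : Fin d) {a : ℝ} (ha : 0 ≤ a)
    (hVA : ∀ (x : Site d) (μ : Fin d), l1 (x - q) ≤ 2 * (d * L) + L + L → ((V x μ : 𝔸ˣ) : 𝔸) = exp (A x μ) ∧ ‖A x μ‖ ≤ a)
    (hsmall : Real.exp (((2 * (d * L) + L + L : ℕ) : ℝ) * a) - 1 ≤ 1 / 2)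
    (f : Fin d → 𝔸) (hf : ∀ (p : Site d) (m : Fin d), asum A p (plaqWord m κ) = f m) :
    ‖(∑ r : Fin d → Fin L, (((L : ℝ) ^ d)⁻¹) • ((((Fintype.card (Equiv.Perm (Fin d)) : ℝ) ^ 2)⁻¹) •
        ∑ σ : Equiv.Perm (Fin d), ∑ σ' : Equiv.Perm (Fin d),
          MatrixLog.mlog ((hol V q (permWord σ (boxVec L r) ++ seg κ L ++ revWord (permWord σ' (boxVec L r)) ++ seg κ (-(L : ℤ))) : 𝔸ˣ) : 𝔸))) - Xavg L V q κ‖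
      ≤ 2 * (expRem (2 * (Real.exp (((2 * (d * L) + L + L : ℕ) : ℝ) * a) - 1))
            + expRem (((2 * (d * L) + L + L : ℕ) : ℝ) * a)) := by
  have h1 := norm_XavgSym_sub_XhatSym_le L hL V A q κ ha hVA hsmall
  have h2 := XhatSym_eq_Xhat_of_const_flux L hL A q κ f hf
  have h3 := norm_Xavg_sub_Xhat_le L hL V A q κ ha hVA hsmall
  set XV : 𝔸 := (∑ r : Fin d → Fin L, (((L : ℝ) ^ d)⁻¹) • ((((Fintype.card (Equiv.Perm (Fin d)) : ℝ) ^ 2)⁻¹) •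
        ∑ σ : Equiv.Perm (Fin d), ∑ σ' : Equiv.Perm (Fin d),
          MatrixLog.mlog ((hol V q (permWord σ (boxVec L r) ++ seg κ L ++ revWord (permWord σ' (boxVec L r)) ++ seg κ (-(L : ℤ))) : 𝔸ˣ) : 𝔸))) with hXV
  set XS : 𝔸 := (∑ r : Fin d → Fin L, (((L : ℝ) ^ d)⁻¹) • ((((Fintype.card (Equiv.Perm (Fin d)) : ℝ) ^ 2)⁻¹) •
        ∑ σ : Equiv.Perm (Fin d), ∑ σ' : Equiv.Perm (Fin d),
          asum A q (permWord σ (boxVec L r) ++ seg κ L ++ revWord (permWord σ' (boxVec L r)) ++ seg κ (-(L : ℤ))))) with hXS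
  calc ‖XV - Xavg L V q κ‖ = ‖(XV - XS) - (Xavg L V q κ - Xhat L A q κ)‖ := by rw [h2]; congr 1; abel
    _ ≤ ‖XV - XS‖ + ‖Xavg L V q κ - Xhat L A q κ‖ := norm_sub_le _ _
    _ ≤ _ := by linarith

/-! ## §4 The recipe's average against (42)'s -/

omit [NormOneClass 𝔸] in
/-- The recipe's exponent is small: `‖XavgSym‖ ≤ 2(e^{ℓa} − 1)` under the local-gauge hypotheses (`|log W| ≤ 2|W − 1|` per loop). [folklore] -/
theorem norm_XavgSym_le (L : ℕ) (hL : 1 ≤ L) (V : Site d → Fin d → 𝔸ˣ) (A : Site d → Fin d → 𝔸) (q : Site d) (κ : Fin d)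
    {a : ℝ} (ha : 0 ≤ a)
    (hVA : ∀ (x : Site d) (μ : Fin d), l1 (x - q) ≤ 2 * (d * L) + L + L → ((V x μ : 𝔸ˣ) : 𝔸) = exp (A x μ) ∧ ‖A x μ‖ ≤ a)
    (hsmall : Real.exp (((2 * (d * L) + L + L : ℕ) : ℝ) * a) - 1 ≤ 1 / 2) :
    ‖(∑ r : Fin d → Fin L, (((L : ℝ) ^ d)⁻¹) • ((((Fintype.card (Equiv.Perm (Fin d)) : ℝ) ^ 2)⁻¹) •
        ∑ σ : Equiv.Perm (Fin d), ∑ σ' : Equiv.Perm (Fin d),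
          MatrixLog.mlog ((hol V q (permWord σ (boxVec L r) ++ seg κ L ++ revWord (permWord σ' (boxVec L r)) ++ seg κ (-(L : ℤ))) : 𝔸ˣ) : 𝔸)))‖ ≤ 2 * (Real.exp (((2 * (d * L) + L + L : ℕ) : ℝ) * a) - 1) := by
  set ℓ : ℕ := 2 * (d * L) + L + L with hℓ
  set B : ℝ := 2 * (Real.exp ((ℓ : ℝ) * a) - 1) with hB
  set N : ℝ := (Fintype.card (Equiv.Perm (Fin d)) : ℝ) with hNdef
  have hN : N ≠ 0 := by rw [hNdef]; exact_mod_cast Fintype.card_ne_zero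
  have hNpos : 0 < N := by rw [hNdef]; exact_mod_cast Fintype.card_pos
  have hL0 : (0 : ℝ) < (L : ℝ) ^ d := pow_pos (by exact_mod_cast (by omega : 0 < L)) _
  have hterm : ∀ (r : Fin d → Fin L) (σ σ' : Equiv.Perm (Fin d)),
      ‖MatrixLog.mlog ((hol V q (permWord σ (boxVec L r) ++ seg κ L ++ revWord (permWord σ' (boxVec L r)) ++ seg κ (-(L : ℤ))) : 𝔸ˣ) : 𝔸)‖
        ≤ B := by
    intro r σ σ'
    set w := permWord σ (boxVec L r) ++ seg κ L ++ revWord (permWord σ' (boxVec L r)) ++ seg κ (-(L : ℤ)) with hw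
    have hlen : w.length ≤ ℓ := length_symLoop_le L κ σ σ' r
    have hna : (w.length : ℝ) * a ≤ (ℓ : ℝ) * a := mul_le_mul_of_nonneg_right (by exact_mod_cast hlen) ha
    have hexp : Real.exp (w.length * a) - 1 ≤ Real.exp ((ℓ : ℝ) * a) - 1 := by linarith [Real.exp_le_exp.mpr hna]
    have h1 := (walk_linear V A q ℓ ha hVA w q (by simp [l1]; exact hlen)).1
    have hW : ‖((hol V q w : 𝔸ˣ) : 𝔸) - 1‖ ≤ 1 / 2 := h1.trans (hexp.trans hsmall)
    exact (MatrixLog.norm_mlog_le_two_mul hW).trans (by linarith)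
  calc ‖∑ r : Fin d → Fin L, (((L : ℝ) ^ d)⁻¹) • ((N ^ 2)⁻¹ • ∑ σ : Equiv.Perm (Fin d), ∑ σ' : Equiv.Perm (Fin d),
          MatrixLog.mlog ((hol V q (permWord σ (boxVec L r) ++ seg κ L ++ revWord (permWord σ' (boxVec L r)) ++ seg κ (-(L : ℤ))) : 𝔸ˣ) : 𝔸))‖
      ≤ ∑ r : Fin d → Fin L, ‖(((L : ℝ) ^ d)⁻¹) • ((N ^ 2)⁻¹ • ∑ σ : Equiv.Perm (Fin d), ∑ σ' : Equiv.Perm (Fin d),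
          MatrixLog.mlog ((hol V q (permWord σ (boxVec L r) ++ seg κ L ++ revWord (permWord σ' (boxVec L r)) ++ seg κ (-(L : ℤ))) : 𝔸ˣ) : 𝔸))‖ :=
        norm_sum_le _ _
    _ ≤ ∑ _r : Fin d → Fin L, ((L : ℝ) ^ d)⁻¹ * B := Finset.sum_le_sum fun r _ => by
        rw [norm_smul, norm_inv, Real.norm_of_nonneg hL0.le]
        refine mul_le_mul_of_nonneg_left ?_ (by positivity)
        rw [norm_smul, norm_inv, norm_pow, Real.norm_of_nonneg hNpos.le]
        calc (N ^ 2)⁻¹ * ‖∑ σ : Equiv.Perm (Fin d), ∑ σ' : Equiv.Perm (Fin d),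
                MatrixLog.mlog ((hol V q (permWord σ (boxVec L r) ++ seg κ L ++ revWord (permWord σ' (boxVec L r)) ++ seg κ (-(L : ℤ))) : 𝔸ˣ) : 𝔸)‖
            ≤ (N ^ 2)⁻¹ * ∑ σ : Equiv.Perm (Fin d), ∑ σ' : Equiv.Perm (Fin d), B :=
              mul_le_mul_of_nonneg_left ((norm_sum_le _ _).trans (Finset.sum_le_sum fun σ _ =>
                (norm_sum_le _ _).trans (Finset.sum_le_sum fun σ' _ => hterm r σ σ'))) (by positivity)
          _ = B := by
              rw [Finset.sum_const, Finset.sum_const, Finset.card_univ, nsmul_eq_mul, nsmul_eq_mul, ← hNdef]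
              field_simp
    _ = B := by
        rw [Finset.sum_const, Finset.card_univ, Fintype.card_fun, Fintype.card_fin, Fintype.card_fin, nsmul_eq_mul]
        push_cast
        field_simp

/-- **★★ THE NON-ABELIAN RECIPE AGAINST (42), AVERAGES**: for a `U1`-valued `V` written near the block as `V_b = e^{A_b}` (`‖A_b‖ ≤ a`,
`e^{ℓa} − 1 ≤ ½`) with `δ`-Lipschitz circulations in the planes `(m, κ)`:
`‖bavgSymNA[V](c) − V̄_c‖ ≤ e·(d(d+2)L³·δ + 2ρ₂(ℓ,a))` (common straight transporter of norm `≤ 1`; exponents of norm `≤ 1`; `exp` `e`-Lipschitz on that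
ball, `D4WalkBlockExpWindow.norm_exp_sub_exp_le`). [folklore] -/
theorem norm_bavgSymNA_sub_bavg_le (L : ℕ) (hL : 1 ≤ L) (V : Site d → Fin d → 𝔸ˣ) (hV : ∀ (x : Site d) (μ : Fin d), V x μ ∈ U1 𝔸)
    (A : Site d → Fin d → 𝔸) (q : Site d) (κ : Fin d) {a : ℝ} (ha : 0 ≤ a)
    (hVA : ∀ (x : Site d) (μ : Fin d), l1 (x - q) ≤ 2 * (d * L) + L + L → ((V x μ : 𝔸ˣ) : 𝔸) = exp (A x μ) ∧ ‖A x μ‖ ≤ a)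
    (hsmall : Real.exp (((2 * (d * L) + L + L : ℕ) : ℝ) * a) - 1 ≤ 1 / 2) {δ : ℝ} (hδ0 : 0 ≤ δ)
    (hδ : ∀ (p : Site d) (m : Fin d), l1 (p - q) ≤ (d + 2) * L →
      ‖asum A p (plaqWord m κ) - asum A q (plaqWord m κ)‖ ≤ δ * l1 (p - q)) :
    ‖((expUnit (∑ r : Fin d → Fin L, (((L : ℝ) ^ d)⁻¹) • ((((Fintype.card (Equiv.Perm (Fin d)) : ℝ) ^ 2)⁻¹) •
        ∑ σ : Equiv.Perm (Fin d), ∑ σ' : Equiv.Perm (Fin d),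
          MatrixLog.mlog ((hol V q (permWord σ (boxVec L r) ++ seg κ L ++ revWord (permWord σ' (boxVec L r)) ++ seg κ (-(L : ℤ))) : 𝔸ˣ) : 𝔸))) * hol V q (seg κ L) : 𝔸ˣ) : 𝔸) - ((bavg L V q κ : 𝔸ˣ) : 𝔸)‖
      ≤ Real.exp 1 * (d * (d + 2) * (L : ℝ) ^ 3 * δ
        + 2 * (expRem (2 * (Real.exp (((2 * (d * L) + L + L : ℕ) : ℝ) * a) - 1))
            + expRem (((2 * (d * L) + L + L : ℕ) : ℝ) * a))) := by
  set X₁ := (∑ r : Fin d → Fin L, (((L : ℝ) ^ d)⁻¹) • ((((Fintype.card (Equiv.Perm (Fin d)) : ℝ) ^ 2)⁻¹) •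
        ∑ σ : Equiv.Perm (Fin d), ∑ σ' : Equiv.Perm (Fin d),
          MatrixLog.mlog ((hol V q (permWord σ (boxVec L r) ++ seg κ L ++ revWord (permWord σ' (boxVec L r)) ++ seg κ (-(L : ℤ))) : 𝔸ˣ) : 𝔸))) with hX₁
  set X₂ := Xavg L V q κ with hX₂
  have hnorm_h : ‖((hol V q (seg κ L) : 𝔸ˣ) : 𝔸)‖ ≤ 1 := (mem_U1.mp (hol_mem hV _ _)).1
  have hb₁ : ((expUnit (∑ r : Fin d → Fin L, (((L : ℝ) ^ d)⁻¹) • ((((Fintype.card (Equiv.Perm (Fin d)) : ℝ) ^ 2)⁻¹) •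
        ∑ σ : Equiv.Perm (Fin d), ∑ σ' : Equiv.Perm (Fin d),
          MatrixLog.mlog ((hol V q (permWord σ (boxVec L r) ++ seg κ L ++ revWord (permWord σ' (boxVec L r)) ++ seg κ (-(L : ℤ))) : 𝔸ˣ) : 𝔸))) * hol V q (seg κ L) : 𝔸ˣ) : 𝔸) = exp X₁ * ((hol V q (seg κ L) : 𝔸ˣ) : 𝔸) := by
    rw [Units.val_mul, val_expUnit]
  have hb₂ : ((bavg L V q κ : 𝔸ˣ) : 𝔸) = exp X₂ * ((hol V q (seg κ L) : 𝔸ˣ) : 𝔸) := by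
    rw [show bavg L V q κ = expUnit X₂ * hol V q (seg κ L) from rfl, Units.val_mul, val_expUnit]
  have hX₁le : ‖X₁‖ ≤ 1 := (norm_XavgSym_le L hL V A q κ ha hVA hsmall).trans (by linarith)
  have hX₂le : ‖X₂‖ ≤ 1 := (norm_Xavg_le L hL V A q κ ha hVA hsmall).trans (by linarith)
  have hexp := Summit.QuantumFields.BalabanUV.Gaps.D4WalkBlockExpWindow.norm_exp_sub_exp_le X₁ X₂ hX₁le hX₂le
  have hdef := norm_XavgSym_sub_Xavg_le L hL V A q κ ha hVA hsmall hδ0 hδ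
  rw [hb₁, hb₂, ← sub_mul]
  calc ‖(exp X₁ - exp X₂) * ((hol V q (seg κ L) : 𝔸ˣ) : 𝔸)‖
      ≤ ‖exp X₁ - exp X₂‖ * ‖((hol V q (seg κ L) : 𝔸ˣ) : 𝔸)‖ := norm_mul_le _ _
    _ ≤ ‖exp X₁ - exp X₂‖ * 1 := mul_le_mul_of_nonneg_left hnorm_h (norm_nonneg _)
    _ ≤ ‖X₁ - X₂‖ * Real.exp 1 := by rw [mul_one]; exact hexp
    _ ≤ _ := by rw [mul_comm]; exact mul_le_mul_of_nonneg_left hdef (Real.exp_pos 1).le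

end

end Summit.QuantumFields.YangMills.BalabanUVNodes.N16Eq42VsSymmetrisedNonAbelian
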